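import Summits.Ventures.PercRepro.C026MarkCEdge
import Summits.Ventures.PercRepro.C026Independence

/-!
# SA at a bridge (p6, gen 15; MINE3-SUPERADD §3 (b))

Uses the independence across a cut of `C026Independence` (`prob_inter_eq_mul_of_dependsOn`).

**SA at a bridge.** Let `e` be a bridge: the vertices split into `X ∋ a` and `Y ∋ b, c` and every other
edge has both endpoints in `X` or both in `Y` (`IsBridgeCut`).  With `e` closed, clusters stay on their
side (`conn_update_false_mem_side`), so `{a ↔ x}` depends on the `X`-edges and `{c ↔ y}`, `{y ↔ b}`,
`{c ↔ b}` on the `Y`-edges.  Then `I_D = P(a ↔ x)·P(c ↔ y ∧ c ↮ b)`, `I_A = P(a ↔ x)·P(y ↔ b)`,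
`f(H − e) = P(c ↔ b)`, and Harris on the `Y`-side gives
`I_D · I_A ≤ P(c ↔ y) P(y ↔ b) ≤ P(c ↔ y ∧ y ↔ b) ≤ P(c ↔ b) = f(H − e)`
(`pivD26_mul_pivA26_le_slack_update_zero_of_bridge`); hence SA holds at every bridge once the
contraction minor satisfies C-026 (`Mix26_of_bridge`).  So the content of SA lies on cycles.
-/

namespace PercRepro

open Finset


namespace MultiGraph

variable {V E : Type*} (G : MultiGraph V E) [Fintype E] [DecidableEq E]

/-! ### Bridges -/

/-- **A bridge cut**: the edge `e` is the only edge between the vertex class `X` and its complement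
(every other edge has both endpoints in `X` or both outside). -/
def IsBridgeCut (e : E) (X : Set V) : Prop :=
  ∀ e', e' ≠ e → (G.fst e' ∈ X ↔ G.snd e' ∈ X)

open Classical in
/-- The edges with both endpoints in `X`. -/
noncomputable def sideEdges (X : Set V) : Finset E :=
  univ.filter fun e' => G.fst e' ∈ X ∧ G.snd e' ∈ X

omit [Fintype E] in
/-- With the bridge closed, clusters of `X`-vertices stay in `X`. -/
theorem mem_of_conn_update_false_of_bridge {e : E} {X : Set V} (hX : G.IsBridgeCut e X)
    {ω : Config E} {u v : V} (hu : u ∈ X) (h : G.Conn (Function.update ω e false) u v) : v ∈ X := by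
  refine mem_of_conn_of_closed_boundary (X := X) (fun e' he' => ?_) hu h
  have hne : e' ≠ e := by
    rintro rfl
    simp at he'
  exact hX e' hne

/-- With the bridge closed, a connection from an `X`-vertex depends only on the `X`-edges. -/
theorem dependsOn_lift_false_connEvent_of_mem {e : E} {X : Set V} (hX : G.IsBridgeCut e X)
    {u : V} (hu : u ∈ X) (v : V) :
    DependsOn (G.sideEdges X) (lift e false (G.connEvent u v)) := by
  -- a path with `e` closed from `u ∈ X` uses only `X`-edges, which agree
  have key : ∀ ω ω' : Config E, (∀ e' ∈ G.sideEdges X, ω e' = ω' e') →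
      G.Conn (Function.update ω e false) u v → G.Conn (Function.update ω' e false) u v := by
    intro ω ω' h hconn
    unfold Conn at hconn ⊢
    refine Conn.induction (motive := fun w => w ∈ X ∧ G.Conn (Function.update ω' e false) u w)
      ⟨hu, Conn.refl G _ u⟩ (fun {x y} _ hxy hx => ?_) hconn |>.2
    obtain ⟨f, hf, hend⟩ := hxy
    have hfe : f ≠ e := by
      rintro rfl
      simp at hf
    have hfx : ω f = true := by rwa [Function.update_of_ne hfe] at hf
    have hboth : G.fst f ∈ X ∧ G.snd f ∈ X := by
      rcases hend with ⟨h1, h2⟩ | ⟨h1, h2⟩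
      · exact ⟨h1 ▸ hx.1, (hX f hfe).1 (h1 ▸ hx.1)⟩
      · exact ⟨(hX f hfe).2 (h2 ▸ hx.1), h2 ▸ hx.1⟩
    have hmem : f ∈ G.sideEdges X := by
      simp only [sideEdges, Finset.mem_filter, Finset.mem_univ, true_and]
      exact hboth
    have hf' : Function.update ω' e false f = true := by
      rw [Function.update_of_ne hfe, ← h f hmem]
      exact hfx
    have hy : y ∈ X := by
      rcases hend with ⟨h1, h2⟩ | ⟨h1, h2⟩
      · exact h2 ▸ hboth.2
      · exact h1 ▸ hboth.1
    exact ⟨hy, hx.2.trans (Conn.of_openAdj ⟨f, hf', hend⟩)⟩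
  intro ω ω' h
  constructor
  · exact key ω ω' h
  · exact key ω' ω (fun e' he' => (h e' he').symm)

omit [Fintype E] [DecidableEq E] in
/-- Monotonicity of `DependsOn` in the edge set. -/
theorem DependsOn.mono' {S S' : Finset E} (hSS : S ⊆ S') {A : Set (Config E)} (hA : DependsOn S A) :
    DependsOn S' A :=
  fun ω ω' h => hA ω ω' fun e he => h e (hSS he)

omit [Fintype E] [DecidableEq E] in
/-- A bridge cut for `X` is a bridge cut for the other side. -/
theorem IsBridgeCut.compl {e : E} {X : Set V} (hX : G.IsBridgeCut e X) : G.IsBridgeCut e Xᶜ :=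
  fun e' he' => by simp only [Set.mem_compl_iff, hX e' he']

/-- The edges inside the other side avoid the edges inside `X`. -/
theorem sideEdges_compl_subset (X : Set V) : G.sideEdges Xᶜ ⊆ (G.sideEdges X)ᶜ := by
  intro e' he'
  simp only [sideEdges, Finset.mem_filter, Finset.mem_univ, true_and, Set.mem_compl_iff] at he'
  simp only [Finset.mem_compl, sideEdges, Finset.mem_filter, Finset.mem_univ, true_and, not_and]
  intro h
  exact absurd h he'.1

/-- With the bridge closed, a connection from a vertex outside `X` depends only on the edges outside
the `X`-edges. -/
theorem dependsOn_compl_lift_false_connEvent_of_notMem {e : E} {X : Set V} (hX : G.IsBridgeCut e X)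
    {u : V} (hu : u ∉ X) (v : V) :
    DependsOn (G.sideEdges X)ᶜ (lift e false (G.connEvent u v)) :=
  DependsOn.mono' (G.sideEdges_compl_subset X)
    (G.dependsOn_lift_false_connEvent_of_mem hX.compl (Set.mem_compl hu) v)

omit [Fintype E] in
/-- Across a closed bridge there is no connection. -/
theorem lift_false_connEvent_eq_empty_of_bridge {e : E} {X : Set V} (hX : G.IsBridgeCut e X)
    {u v : V} (hu : u ∈ X) (hv : v ∉ X) : lift e false (G.connEvent u v) = ∅ := by
  ext ω
  simp only [mem_lift, mem_connEvent, Set.mem_empty_iff_false, iff_false]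
  intro h
  exact hv (G.mem_of_conn_update_false_of_bridge hX hu h)

omit [Fintype E] in
/-- **Opening the bridge** `e = xy` (`x ∈ X`, `y ∉ X`): `u ∈ X` reaches `v ∉ X` iff `u ↔ x` and `y ↔ v`
with `e` closed. -/
theorem lift_true_connEvent_eq_of_bridge {e : E} {X : Set V} (hX : G.IsBridgeCut e X) {x y : V}
    (hend : (G.fst e = x ∧ G.snd e = y) ∨ (G.fst e = y ∧ G.snd e = x)) (hy : y ∉ X)
    {u v : V} (hu : u ∈ X) (hv : v ∉ X) :
    lift e true (G.connEvent u v) = lift e false (G.connEvent u x) ∩ lift e false (G.connEvent y v) := by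
  ext ω
  simp only [mem_lift, Set.mem_inter_iff, mem_connEvent]
  have h1 : Function.update ω e true = Function.update (Function.update ω e false) e true := by
    rw [Function.update_idem]
  rw [h1, conn_update_true_iff]
  constructor
  · rintro (h | ⟨h1, h2⟩ | ⟨h1, h2⟩)
    · exact absurd (G.mem_of_conn_update_false_of_bridge hX hu h) hv
    · rcases hend with ⟨hfx, hsy⟩ | ⟨hfy, hsx⟩
      · rw [hfx] at h1; rw [hsy] at h2; exact ⟨h1, h2⟩
      · rw [hfy] at h1; exact absurd (G.mem_of_conn_update_false_of_bridge hX hu h1) hy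
    · rcases hend with ⟨hfx, hsy⟩ | ⟨hfy, hsx⟩
      · rw [hsy] at h1; exact absurd (G.mem_of_conn_update_false_of_bridge hX hu h1) hy
      · rw [hsx] at h1; rw [hfy] at h2; exact ⟨h1, h2⟩
  · rintro ⟨h1, h2⟩
    rcases hend with ⟨hfx, hsy⟩ | ⟨hfy, hsx⟩
    · exact Or.inr (Or.inl ⟨hfx ▸ h1, hsy ▸ h2⟩)
    · exact Or.inr (Or.inr ⟨hsx ▸ h1, hfy ▸ h2⟩)

/-- **SA at a bridge** (MINE3-SUPERADD §3 (b), Harris only): at a bridge `e = xy` separating `a` (side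
`X`) from `b` and `c`, `I_D · I_A ≤ f(H − e)`. -/
theorem pivD26_mul_pivA26_le_slack_update_zero_of_bridge {p : E → ℝ} (hp : IsProb p) {e : E}
    {X : Set V} (hX : G.IsBridgeCut e X) {x y : V}
    (hend : (G.fst e = x ∧ G.snd e = y) ∨ (G.fst e = y ∧ G.snd e = x)) (hx : x ∈ X) (hy : y ∉ X)
    {a b c : V} (ha : a ∈ X) (hb : b ∉ X) (hc : c ∉ X) :
    G.pivD26 p e a b c * G.pivA26 p e a b c ≤ G.slack26 (Function.update p e 0) a b c := by
  -- the events with `e` closed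
  have hA0 : lift e false (G.connEvent a b) = ∅ := G.lift_false_connEvent_eq_empty_of_bridge hX ha hb
  have hca : lift e false (G.connEvent c a) = ∅ := by
    rw [G.connEvent_comm c a]
    exact G.lift_false_connEvent_eq_empty_of_bridge hX ha hc
  have hA1 : lift e true (G.connEvent a b) =
      lift e false (G.connEvent a x) ∩ lift e false (G.connEvent y b) :=
    G.lift_true_connEvent_eq_of_bridge hX hend hy ha hb
  have hcx : ∀ ω : Config E, ¬ G.Conn (Function.update ω e false) c x := fun ω h =>
    (G.mem_of_conn_update_false_of_bridge hX.compl (Set.mem_compl hc) h) hx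
  have hxb : ∀ ω : Config E, ¬ G.Conn (Function.update ω e false) x b := fun ω h =>
    hb (G.mem_of_conn_update_false_of_bridge hX hx h)
  have hB1 : lift e true (G.connEvent c a ∪ G.connEvent c b) =
      lift e false (G.connEvent c b) ∪
        (lift e false (G.connEvent c y) ∩ lift e false (G.connEvent a x)) := by
    have h1 : lift e true (G.connEvent c a) =
        lift e false (G.connEvent c y) ∩ lift e false (G.connEvent a x) := by
      rw [G.connEvent_comm c a, G.lift_true_connEvent_eq_of_bridge hX hend hy ha hc,
        G.connEvent_comm y c, Set.inter_comm]
    have h2 : lift e true (G.connEvent c b) = lift e false (G.connEvent c b) := by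
      ext ω
      simp only [mem_lift, mem_connEvent]
      have h1' : Function.update ω e true = Function.update (Function.update ω e false) e true := by
        rw [Function.update_idem]
      rw [h1', conn_update_true_iff]
      constructor
      · rintro (h | ⟨h1, h2⟩ | ⟨h1, h2⟩)
        · exact h
        · rcases hend with ⟨hfx, hsy⟩ | ⟨hfy, hsx⟩
          · rw [hfx] at h1; exact absurd h1 (hcx ω)
          · rw [hsx] at h2; exact absurd h2 (hxb ω)
        · rcases hend with ⟨hfx, hsy⟩ | ⟨hfy, hsx⟩
          · rw [hfx] at h2; exact absurd h2 (hxb ω)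
          · rw [hsx] at h1; exact absurd h1 (hcx ω)
      · intro h
        exact Or.inl h
    show lift e true (G.connEvent c a) ∪ lift e true (G.connEvent c b) = _
    rw [h1, h2, Set.union_comm]
  -- the pivotal differences and the deletion slack
  have hdepAx : DependsOn (G.sideEdges X) (lift e false (G.connEvent a x)) :=
    G.dependsOn_lift_false_connEvent_of_mem hX ha x
  have hdepYb : DependsOn (G.sideEdges X)ᶜ (lift e false (G.connEvent y b)) :=
    G.dependsOn_compl_lift_false_connEvent_of_notMem hX hy b
  have hdepCy : DependsOn (G.sideEdges X)ᶜ (lift e false (G.connEvent c y)) :=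
    G.dependsOn_compl_lift_false_connEvent_of_notMem hX hc y
  have hdepCb : DependsOn (G.sideEdges X)ᶜ (lift e false (G.connEvent c b)) :=
    G.dependsOn_compl_lift_false_connEvent_of_notMem hX hc b
  have hpA : G.pivA26 p e a b c =
      prob p (lift e false (G.connEvent a x)) * prob p (lift e false (G.connEvent y b)) := by
    rw [G.pivA26_eq_prob_pivEvent, pivEvent, hA1, hA0, Set.compl_empty, Set.inter_univ]
    exact prob_inter_eq_mul_of_dependsOn p hdepAx hdepYb
  have hpD : G.pivD26 p e a b c =
      prob p (lift e false (G.connEvent a x)) *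
        prob p (lift e false (G.connEvent c y) ∩ (lift e false (G.connEvent c b))ᶜ) := by
    rw [G.pivD26_eq_prob_pivEvent, pivEvent, hB1]
    have hB0 : lift e false (G.connEvent c a ∪ G.connEvent c b) = lift e false (G.connEvent c b) := by
      show lift e false (G.connEvent c a) ∪ lift e false (G.connEvent c b) = _
      rw [hca, Set.empty_union]
    rw [hB0]
    have hset : (lift e false (G.connEvent c b) ∪
        lift e false (G.connEvent c y) ∩ lift e false (G.connEvent a x)) ∩
        (lift e false (G.connEvent c b))ᶜ =
        lift e false (G.connEvent a x) ∩
          (lift e false (G.connEvent c y) ∩ (lift e false (G.connEvent c b))ᶜ) := by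
      ext ω
      simp only [Set.mem_inter_iff, Set.mem_union, Set.mem_compl_iff]
      tauto
    rw [hset]
    exact prob_inter_eq_mul_of_dependsOn p hdepAx (hdepCy.inter hdepCb.compl)
  have hf : G.slack26 (Function.update p e 0) a b c = prob p (lift e false (G.connEvent c b)) := by
    rw [slack26_update_zero_eq_mixedSlack]
    unfold mixedSlack
    have hB0 : lift e false (G.connEvent c a ∪ G.connEvent c b) = lift e false (G.connEvent c b) := by
      show lift e false (G.connEvent c a) ∪ lift e false (G.connEvent c b) = _
      rw [hca, Set.empty_union]
    rw [hB0, hA0, Set.compl_empty, Set.inter_univ, prob_univ]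
    ring
  rw [hpA, hpD, hf]
  -- Harris on the far side, and the subset `{c ↔ y} ∩ {y ↔ b} ⊆ {c ↔ b}`
  have hsub : lift e false (G.connEvent c y) ∩ lift e false (G.connEvent y b) ⊆
      lift e false (G.connEvent c b) := by
    rintro ω ⟨h1, h2⟩
    exact (mem_lift.1 h1).trans (mem_lift.1 h2)
  have hHarris := harris hp (isUpperSet_lift e false (G.isUpperSet_connEvent c y))
    (isUpperSet_lift e false (G.isUpperSet_connEvent y b))
  have h1 := prob_mono hp hsub
  have h2 : prob p (lift e false (G.connEvent c y) ∩ (lift e false (G.connEvent c b))ᶜ) ≤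
      prob p (lift e false (G.connEvent c y)) := prob_inter_le_left hp _ _
  have hAx1 := prob_le_one hp (lift e false (G.connEvent a x))
  have hAx0 := prob_nonneg hp (lift e false (G.connEvent a x))
  have hYb0 := prob_nonneg hp (lift e false (G.connEvent y b))
  have hCy0 := prob_nonneg hp (lift e false (G.connEvent c y))
  have hCyb0 := prob_nonneg hp (lift e false (G.connEvent c y) ∩ (lift e false (G.connEvent c b))ᶜ)
  have hYb1 := prob_le_one hp (lift e false (G.connEvent y b))
  nlinarith [mul_le_mul_of_nonneg_right h2 hYb0, mul_nonneg hAx0 hYb0, mul_nonneg hCyb0 hYb0,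
    mul_le_mul_of_nonneg_right hAx1 (mul_nonneg hCyb0 hYb0),
    mul_le_mul_of_nonneg_left hAx1 (mul_nonneg hAx0 (mul_nonneg hCyb0 hYb0))]

omit [Fintype E] in
/-- Across a bridge, opening `e` creates no connection between two vertices on the same side. -/
theorem lift_true_connEvent_eq_lift_false_of_same_side {e : E} {X : Set V} (hX : G.IsBridgeCut e X)
    {x y : V} (hend : (G.fst e = x ∧ G.snd e = y) ∨ (G.fst e = y ∧ G.snd e = x)) (hx : x ∈ X)
    (hy : y ∉ X) {u v : V} (huv : (u ∈ X ∧ v ∈ X) ∨ (u ∉ X ∧ v ∉ X)) :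
    lift e true (G.connEvent u v) = lift e false (G.connEvent u v) := by
  -- no connection with `e` closed joins `X` to its complement
  have nyX : ∀ (ω : Config E) (w : V), w ∈ X → ¬ G.Conn (Function.update ω e false) y w :=
    fun _ w hw h => (G.mem_of_conn_update_false_of_bridge hX.compl (Set.mem_compl hy) h) hw
  have nxN : ∀ (ω : Config E) (w : V), w ∉ X → ¬ G.Conn (Function.update ω e false) x w :=
    fun _ w hw h => hw (G.mem_of_conn_update_false_of_bridge hX hx h)
  ext ω
  simp only [mem_lift, mem_connEvent]
  have h1 : Function.update ω e true = Function.update (Function.update ω e false) e true := by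
    rw [Function.update_idem]
  rw [h1, conn_update_true_iff]
  constructor
  · rintro (h | ⟨h1, h2⟩ | ⟨h1, h2⟩)
    · exact h
    · exfalso
      rcases hend with ⟨hfx, hsy⟩ | ⟨hfy, hsx⟩
      · rw [hfx] at h1; rw [hsy] at h2
        rcases huv with ⟨_, hv⟩ | ⟨hu, _⟩
        · exact nyX ω v hv h2
        · exact nxN ω u hu h1.symm
      · rw [hfy] at h1; rw [hsx] at h2
        rcases huv with ⟨hu, _⟩ | ⟨_, hv⟩
        · exact nyX ω u hu h1.symm
        · exact nxN ω v hv h2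
    · exfalso
      rcases hend with ⟨hfx, hsy⟩ | ⟨hfy, hsx⟩
      · rw [hsy] at h1; rw [hfx] at h2
        rcases huv with ⟨hu, _⟩ | ⟨_, hv⟩
        · exact nyX ω u hu h1.symm
        · exact nxN ω v hv h2
      · rw [hsx] at h1; rw [hfy] at h2
        rcases huv with ⟨_, hv⟩ | ⟨hu, _⟩
        · exact nyX ω v hv h2
        · exact nxN ω u hu h1.symm
  · intro h
    exact Or.inl h

/-- `(Mix)_e` is symmetric in the marks `a`, `b`. -/
theorem Mix26_swap (p : E → ℝ) (e : E) (a b c : V) : G.Mix26 p e a b c ↔ G.Mix26 p e b a c := by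
  unfold Mix26
  rw [G.slack26_swap_ab _ a b c, G.slack26_swap_ab _ a b c, G.pivD26_swap_ab, G.pivA26_swap_ab]

/-- **SA at a bridge separating `a` from `b`, `c`** (`Mix`), given C-026 for the contraction minor. -/
theorem Mix26_of_bridge_a {p : E → ℝ} (hp : IsProb p) {e : E} {X : Set V} (hX : G.IsBridgeCut e X)
    {x y : V} (hend : (G.fst e = x ∧ G.snd e = y) ∨ (G.fst e = y ∧ G.snd e = x)) (hx : x ∈ X)
    (hy : y ∉ X) {a b c : V} (ha : a ∈ X) (hb : b ∉ X) (hc : c ∉ X)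
    (h1 : 0 ≤ G.slack26 (Function.update p e 1) a b c) : G.Mix26 p e a b c := by
  unfold Mix26
  have := G.pivD26_mul_pivA26_le_slack_update_zero_of_bridge hp hX hend hx hy ha hb hc
  linarith

/-- **SA at a bridge with `a`, `b` on one side** (`c` anywhere): `I_A = 0`, so `(Mix)` needs only the
two minors. -/
theorem Mix26_of_bridge_ab {p : E → ℝ} {e : E} {X : Set V} (hX : G.IsBridgeCut e X)
    {x y : V} (hend : (G.fst e = x ∧ G.snd e = y) ∨ (G.fst e = y ∧ G.snd e = x)) (hx : x ∈ X)
    (hy : y ∉ X) {a b c : V} (hab : (a ∈ X ∧ b ∈ X) ∨ (a ∉ X ∧ b ∉ X))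
    (h0 : 0 ≤ G.slack26 (Function.update p e 0) a b c)
    (h1 : 0 ≤ G.slack26 (Function.update p e 1) a b c) : G.Mix26 p e a b c := by
  unfold Mix26
  have hA : G.pivA26 p e a b c = 0 := by
    rw [pivA26_eq, prob_update_one_eq_prob_lift, prob_update_zero_eq_prob_lift,
      G.lift_true_connEvent_eq_lift_false_of_same_side hX hend hx hy hab, sub_self]
  rw [hA, mul_zero]
  linarith

/-- **SA at every bridge** (MINE3-SUPERADD §3 (b)): whatever the sides of the marks, `(Mix)_e` holds at
a bridge `e` once both minors satisfy C-026 — so the content of SA lies on the edges of cycles. -/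
theorem Mix26_of_bridge {p : E → ℝ} (hp : IsProb p) {e : E} {X : Set V} (hX : G.IsBridgeCut e X)
    {x y : V} (hend : (G.fst e = x ∧ G.snd e = y) ∨ (G.fst e = y ∧ G.snd e = x)) (hx : x ∈ X)
    (hy : y ∉ X) {a b c : V}
    (h0 : 0 ≤ G.slack26 (Function.update p e 0) a b c)
    (h1 : 0 ≤ G.slack26 (Function.update p e 1) a b c) : G.Mix26 p e a b c := by
  by_cases hab : (a ∈ X ∧ b ∈ X) ∨ (a ∉ X ∧ b ∉ X)
  · exact G.Mix26_of_bridge_ab hX hend hx hy hab h0 h1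
  · -- `a` and `b` on different sides: the mark alone with... pick the side of `c`
    by_cases ha : a ∈ X
    · have hb : b ∉ X := fun hb => hab (Or.inl ⟨ha, hb⟩)
      by_cases hc : c ∈ X
      · -- `b` alone on the far side: swap the marks and the sides
        rw [G.Mix26_swap]
        have hend' : (G.fst e = y ∧ G.snd e = x) ∨ (G.fst e = x ∧ G.snd e = y) := hend.symm
        rw [G.slack26_swap_ab] at h1
        exact G.Mix26_of_bridge_a hp hX.compl hend' (Set.mem_compl hy) (fun h => h hx)
          (Set.mem_compl hb) (fun h => h ha) (fun h => h hc) h1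
      · exact G.Mix26_of_bridge_a hp hX hend hx hy ha hb hc h1
    · have hb : b ∈ X := by
        by_contra hb
        exact hab (Or.inr ⟨ha, hb⟩)
      by_cases hc : c ∈ X
      · -- `a` alone on the far side
        have hend' : (G.fst e = y ∧ G.snd e = x) ∨ (G.fst e = x ∧ G.snd e = y) := hend.symm
        exact G.Mix26_of_bridge_a hp hX.compl hend' (Set.mem_compl hy) (fun h => h hx)
          (Set.mem_compl ha) (fun h => h hb) (fun h => h hc) h1
      · -- `b` alone on the `X` side: swap the marks
        rw [G.Mix26_swap]
        rw [G.slack26_swap_ab] at h1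
        exact G.Mix26_of_bridge_a hp hX hend hx hy hb ha hc h1

end MultiGraph

end PercRepro
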